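import Summits.BirchSwinnertonDyer.BirchSwinnertonDyer.Theorems.GenusKolyvaginAtTwoGenusPrimitiveSupplyAtTwoArchimedeanCount
import HarnessLib

/-!
# Route `GenusKolyvaginAtTwo`, crux #2 `GenusPrimitiveSupplyAtTwo` (stmt-BirchSwinnertonDyer-22136):
# the archimedean KUMMER count `[Sel^{(n)} relaxed at w : Sel^{(n)} strict at w] = #𝓛_w` at an infinite place `w`
# (part 2 of `…ArchimedeanCount.lean`: X5's self-dual relaxed/strict count ported to an infinite place)

Width seat `bsd-line-gk2-p5` g9 (cell `bsd-f1-sign2`, SUPPLY lineage, «UP general-K lane»), file 18 of the series; continuation of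
`…ArchimedeanCount.lean` (§41 general-place Howard count, §42 archimedean perfectness for `E[n]`), split only for the 400-line cap.
THEOREMS ONLY (no definition, no named fact, no `sorry`); helper `--supports stmt-BirchSwinnertonDyer-22136`; no item is closed;
BSD is not proved by any of this.

* §43 `dualTransported_update_top_inl`, `relIndex_update_bot_update_top_sq_eq_natCard_inl` — X5 `SelfDualCount` §2–§3 at an INFINITE
  place `w` with `inv_w` injective: `[H¹_{𝓛^{w}} : H¹_{𝓛_{w}}]² = #H¹(K_w, E[n])` for `𝓛` residually self-dual away from `w`.
* §44 `natCard_galoisCohomology_one_torsion_inl_eq_sq` (`#H¹(K_w, E[n]) = (#𝓛_w)²`), **`relIndex_kummer_update_bot_update_top_inl_eq`**,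
  `relIndex_kummerStrict_kummerRelaxed_singleton_inl_eq`, **`relIndex_kummerStrict_kummerRelaxed_singleton_inl_eq_of_facts`** — for
  `n = p^k`, any number field `K`, any `E/K`, any infinite place `w`: `[Sel^{(n)} relaxed at w : Sel^{(n)} strict at w] = #𝓛_w`
  (`= [E(K_w) : nE(K_w)]`), modulo the two named facts `poitouTate_selmerStructure_duality_real K` (Milne I 4.10 + Ex. 1.6 (c)) and
  `localEulerPoincareCharacteristic` (Tate) — the real-place companion of X11b's `relIndex_kummerStrict_kummerRelaxed_singleton_eq_of_facts`.
  For `K = ℚ`, `n = 2` the right side is `#E(ℝ)/2E(ℝ) = 2` (`Δ > 0`) or `1` (`Δ < 0`) — Kramer 1981 Prop. 6 (tree, over `ℝ`).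

With this, Mazur–Rubin's Prop. 3.3 / Cor. 3.4 (i) with the ARCHIMEDEAN `T`-place (the cell's T-A `AdmissibleTwistSelmerShiftAtTwo`, T-V
`StrictShaPropagationAtTwo`, -desc's T-C `EggTwistLawAtTwo`) reduces — exactly as at a finite twisting prime (gk2-p5 p620256 DOWN / p628794
UP) — to the transversality of the two Kummer lines at `∞` (Kramer Prop. 6 / MR Lemma 2.9: `H¹_f(E) ∩ H¹_f(E^F) = N E(ℂ)/2E(ℝ) = 0` for
`Δ > 0`, `F` complex) and `#𝓛_∞ = 2`; NOT done here. References: [Howard2004HeegnerKolyvagin] Thm. 2.1.11; [MilneADT2006] I Ex. 1.6 (c),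
Thm. 2.13, Rem. 3.7, Thm. 4.10, Lemma 6.15; [Sakamoto2024] §3.1.2; [Kramer1981] Prop. 6; [MazurRubin2010] Lemma 2.9, Prop. 3.3.
-/

set_option linter.dupNamespace false -- tree convention: `Summit.BirchSwinnertonDyer.BirchSwinnertonDyer.Theorems` (summit = sub-problem)
set_option autoImplicit false

noncomputable section

open scoped Classical ContRepresentation

open CategoryTheory Field Function NumberField IsDedekindDomain WeierstrassCurve
open Literature.NumberTheory.EllipticCurves
open Literature.NumberTheory.GaloisRepresentations
open Literature.NumberTheory.GaloisRepresentations.DiscreteGaloisModule (mu MuCarrier SelmerStructure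
  localTatePairingZMod tateDual localMap)
open Literature.NumberTheory.GaloisCohomology
open Literature.NumberTheory.GaloisCohomology.LocalInvariants
open Summit.BirchSwinnertonDyer.Rank1Residual
open Summit.BirchSwinnertonDyer.Rank1Residual.X11b.FiniteDuality
open Summit.BirchSwinnertonDyer.Rank1Residual.X11b.LocBridge
open Summit.BirchSwinnertonDyer.Rank1Residual.X11b.Levels
open Summit.BirchSwinnertonDyer.Rank1Residual.X11b.PoitouTateCounting (relIndex_selmerGroup_eq)
open Summit.BirchSwinnertonDyer.Rank1Residual.X5.SelfDualCount

namespace Summit.BirchSwinnertonDyer.BirchSwinnertonDyer.Theorems.GenusKolyArch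

-- Cup products need `LocallyCompactSpace Γ`; local instances as in part 1 / X5 `SelfDualCount`.
attribute [local instance] absoluteGaloisGroup_compactSpace
attribute [local instance] finite_geomTorsion_of_neZero Literature.NumberTheory.EllipticCurves.finite_muCarrier

section RealPlace

variable {K : Type} [Field K] [NumberField K] (W : WeierstrassCurve K) (n : ℕ) [NeZero n] [W.IsElliptic]
variable (e : geomTorsion W n → geomTorsion W n → AlgebraicClosure K)
  (hμ : ∀ S T, e S T ^ n = 1)
  (hadd₁ : ∀ S₁ S₂ T, e (S₁ + S₂) T = e S₁ T * e S₂ T)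
  (hadd₂ : ∀ S T₁ T₂, e S (T₁ + T₂) = e S T₁ * e S T₂)
  (hgal : ∀ (σ : absoluteGaloisGroup K) (S T : geomTorsion W n), σ • e S T = e (σ • S) (σ • T))
  (halt : ∀ T, e T T = 1)
  (hnondeg : ∀ T, (∀ S, e S T = 1) → T = 0)
  (inv : LocalInvariants K n)

/-! ## §43 The transported dual of the relaxed structure, and the self-dual count, at an infinite place -/

include halt hnondeg in
/-- **`w⁻¹((𝓛^{w})^*) = (w⁻¹𝓛^*)_{w}` at an INFINITE place `w` with `inv_w` injective** (X5 `dualTransported_update_top`, there at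
a finite place): making `𝓛` RELAXED at `w` makes the transported dual STRICT at `w` — `(H¹(K_w, E[n]))^* = 0`
(`dualLocalCondition_top_of_injective`, from §42) and `H¹(w_w)` is injective.
[cite: Howard2004HeegnerKolyvagin, Def. 2.1.6 (arXiv:1202.6340 p. 5)] [cite: MilneADT2006, Ch. I, Thm. 2.13] -/
theorem dualTransported_update_top_inl (w : InfinitePlace K) (hι : Injective (inv (Sum.inl w)))
    (𝓛 : SelmerStructure (W.torsionGaloisModule n)) :
    inv.dualTransported (Function.update 𝓛 (Sum.inl w) ⊤) (weilDualIntertwining W n e hμ hadd₁ hadd₂ hgal) =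
      Function.update (inv.dualTransported 𝓛 (weilDualIntertwining W n e hμ hadd₁ hadd₂ hgal))
        (Sum.inl w) ⊥ := by
  funext v
  by_cases hv : v = Sum.inl w
  · subst hv
    rw [Function.update_self]
    ext y
    simp only [LocalInvariants.mem_dualTransported_iff, LocalInvariants.dualSelmerStructure_apply,
      Function.update_self, AddSubgroup.mem_bot]
    rw [dualLocalCondition_top_of_injective
      (bijective_localTatePairingZMod_inl W n e hμ hadd₁ hadd₂ hgal halt hnondeg inv w hι).2.1, AddSubgroup.mem_bot]
    constructor
    · intro h
      exact map_weilDual_restrictField_injective W n e hμ hadd₁ hadd₂ hgal hnondeg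
        (Place.Completion (Sum.inl w : Place K)) (h.trans (map_zero _).symm)
    · intro h
      rw [h]
      exact map_zero _
  · rw [Function.update_of_ne hv]
    ext y
    simp only [LocalInvariants.mem_dualTransported_iff, LocalInvariants.dualSelmerStructure_apply,
      Function.update_of_ne hv]

omit [NeZero n] [W.IsElliptic] in
/-- Modifying a Selmer structure unramified outside `S` at an INFINITE place keeps it unramified outside `S`
(`IsUnramifiedOutside` only constrains the finite places off `S`). [cite: Howard2004HeegnerKolyvagin, Def. 2.1.10 (arXiv:1202.6340 p. 6)] -/
theorem isUnramifiedOutside_update_inl {𝓛 : SelmerStructure (W.torsionGaloisModule n)} {S : Finset (Place K)}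
    (h𝓛 : 𝓛.IsUnramifiedOutside S) (w : InfinitePlace K)
    (L : AddSubgroup (galoisCohomology ((W.torsionGaloisModule n).toLocal (Sum.inl w)) 1)) :
    SelmerStructure.IsUnramifiedOutside (Function.update 𝓛 (Sum.inl w) L) S := by
  refine ⟨h𝓛.1, fun v hv => ?_⟩
  rw [Function.update_of_ne Sum.inr_ne_inl]
  exact h𝓛.2 v hv

include halt hnondeg in
/-- **The self-dual relaxed/strict count at one INFINITE place** (X5 `relIndex_update_bot_update_top_sq_eq_natCard`, there at a
finite place): for `𝓛` a Selmer structure on `E[n]` unramified outside `S ∋ w`, residually self-dual away from `w` for the Weil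
transport, and `inv_w` injective, `[H¹_{𝓛^{w}} : H¹_{𝓛_{w}}]² = #H¹(K_w, E[n])`. Proof verbatim from X5 with §41–§43.
[cite: Howard2004HeegnerKolyvagin, Thm. 2.1.11 (arXiv:1202.6340 p. 6)] [cite: MilneADT2006, Ch. I, Thm. 2.13 and Rem. 3.7] -/
theorem relIndex_update_bot_update_top_sq_eq_natCard_inl
    (hvan : inv.SumLocalTermEqZero) (hcomp : inv.SelmerComplement) {S : Finset (Place K)}
    (hS : ∀ v : HeightOneSpectrum (𝓞 K), (Sum.inr v : Place K) ∉ S →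
      ((n : ℕ) : 𝓞 K) ∉ v.asIdeal ∧ GaloisRep.IsUnramifiedAt v (W.torsionGaloisModule n))
    {𝓛 : SelmerStructure (W.torsionGaloisModule n)} (h𝓛 : 𝓛.IsUnramifiedOutside S)
    {w : InfinitePlace K} (hw : (Sum.inl w : Place K) ∈ S) (hι : Injective (inv (Sum.inl w)))
    (hsd : ∀ v ≠ (Sum.inl w : Place K),
      inv.dualTransported 𝓛 (weilDualIntertwining W n e hμ hadd₁ hadd₂ hgal) v = 𝓛 v) :
    ((SelmerStructure.selmerGroup
          (Function.update 𝓛 (Sum.inl w) ⊥ : SelmerStructure (W.torsionGaloisModule n))).relIndex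
        (SelmerStructure.selmerGroup
          (Function.update 𝓛 (Sum.inl w) ⊤ : SelmerStructure (W.torsionGaloisModule n)))) ^ 2 =
      Nat.card (galoisCohomology ((W.torsionGaloisModule n).toLocal (Sum.inl w)) 1) := by
  set v₀ : Place K := Sum.inl w with hv₀def
  set θ := weilDualIntertwining W n e hμ hadd₁ hadd₂ hgal with hθ
  set 𝓕 : SelmerStructure (W.torsionGaloisModule n) := Function.update 𝓛 v₀ ⊥ with h𝓕
  set 𝓖 : SelmerStructure (W.torsionGaloisModule n) := Function.update 𝓛 v₀ ⊤ with h𝓖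
  have hM : ∀ T : geomTorsion W n, n • T = 0 := fun T => AddSubgroup.torsionBy.nsmul T
  haveI := finite_galoisCohomology_one_torsion_inl W n w
  haveI := finite_galoisCohomology_one_tateDual_torsion_inl W n w
  have hbij := bijective_localTatePairingZMod_inl W n e hμ hadd₁ hadd₂ hgal halt hnondeg inv w hι
  -- `w⁻¹𝓕^* = 𝓖` and `w⁻¹𝓖^* = 𝓕`
  have hTF : inv.dualTransported 𝓕 θ = 𝓖 := by
    rw [h𝓕, dualTransported_update_bot]
    funext v
    by_cases hv : v = v₀
    · subst hv; rw [Function.update_self, h𝓖, Function.update_self]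
    · rw [Function.update_of_ne hv, h𝓖, Function.update_of_ne hv, hsd v hv]
  have hTG : inv.dualTransported 𝓖 θ = 𝓕 := by
    rw [h𝓖, hv₀def, dualTransported_update_top_inl W n e hμ hadd₁ hadd₂ hgal halt hnondeg inv w hι]
    funext v
    by_cases hv : v = v₀
    · subst hv; rw [hv₀def, Function.update_self, h𝓕, Function.update_self]
    · rw [← hv₀def, Function.update_of_ne hv, h𝓕, Function.update_of_ne hv, hsd v hv]
  -- the dual Selmer groups are the Weil transports of the Selmer groups of `𝓖`, `𝓕`
  have hdF : (inv.dualSelmerStructure (W.torsionGaloisModule n) 𝓕).selmerGroup =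
      𝓖.selmerGroup.map (galoisCohomology.map θ 1) := by
    rw [dualSelmerGroup_eq_map_selmerGroup_dualTransported W n e hμ hadd₁ hadd₂ hgal hnondeg inv 𝓕, hTF]
  have hdG : (inv.dualSelmerStructure (W.torsionGaloisModule n) 𝓖).selmerGroup =
      𝓕.selmerGroup.map (galoisCohomology.map θ 1) := by
    rw [dualSelmerGroup_eq_map_selmerGroup_dualTransported W n e hμ hadd₁ hadd₂ hgal hnondeg inv 𝓖, hTG]
  -- the counting form at the one place `v₀`
  have hcount := relIndex_selmerGroup_mul_relIndex_dual_eq_of_bijective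
    (ρ := W.torsionGaloisModule n) (𝓕 := 𝓕) (𝓖 := 𝓖) (v₀ := v₀) hbij hvan hcomp hM hS
    (update_bot_le_update_top W n 𝓛 v₀)
    (isUnramifiedOutside_update_inl W n h𝓛 w ⊥) (isUnramifiedOutside_update_inl W n h𝓛 w ⊤) hw
    (fun v hv => update_bot_eq_update_top_of_ne W n 𝓛 v₀ v hv)
  rw [hdF, hdG, AddSubgroup.relIndex_map_map_of_injective _ _
    (map_weilDual_injective W n e hμ hadd₁ hadd₂ hgal hnondeg)] at hcount
  -- `[⊤ : ⊥] = #H¹(K_{v₀}, E[n])`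
  have hbt : (𝓕 v₀).relIndex (𝓖 v₀) =
      Nat.card (galoisCohomology ((W.torsionGaloisModule n).toLocal v₀) 1) := by
    rw [h𝓕, h𝓖, Function.update_self, Function.update_self, AddSubgroup.relIndex_bot_left,
      AddSubgroup.card_top]
  rw [sq, ← hbt]
  exact hcount

/-! ## §44 THE ARCHIMEDEAN KUMMER COUNT: `[Sel^{(n)} relaxed at w : Sel^{(n)} strict at w] = #𝓛_w` -/

include hμ hadd₁ hadd₂ hgal halt hnondeg in
/-- **`#H¹(K_w, E[n]) = (#𝓛_w)²` at an infinite place `w` with `inv_w` injective** — the local Kummer condition `𝓛_w` is its own right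
annihilator under `inv_w(· ∪ₑ ·)` (X5 `annRight_invWeilPairing_kummerSelmerStructure_inl_of_injective`) and `#𝓛^⊥ · #𝓛 = #H¹`
(`natCard_annRight_mul`, both adjoints of the Weil self-pairing being bijective, Milne I Thm. 2.13).
[cite: MilneADT2006, Ch. I, Thm. 2.13 and Rem. 3.7] [cite: PoonenRains2012, Prop. 4.10] -/
theorem natCard_galoisCohomology_one_torsion_inl_eq_sq (w : InfinitePlace K) (hι : Injective (inv (Sum.inl w))) :
    Nat.card (galoisCohomology ((W.torsionGaloisModule n).toLocal (Sum.inl w)) 1) =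
      Nat.card (W.kummerSelmerStructure n (Sum.inl w)) * Nat.card (W.kummerSelmerStructure n (Sum.inl w)) := by
  set b := X11b.Relaxation.invWeilPairing W n e hμ hadd₁ hadd₂ hgal inv (Sum.inl w) with hb
  set L := W.kummerSelmerStructure n (Sum.inl w) with hL
  haveI := finite_galoisCohomology_one_torsion_inl W n w
  have hA : ∀ x : galoisCohomology ((W.torsionGaloisModule n).toLocal (Sum.inl w)) 1, n • x = 0 :=
    nsmul_continuousCohomology_one_eq_zero _ n (fun T : geomTorsion W n => AddSubgroup.torsionBy.nsmul T)
  have hp : Bijective b ∧ Bijective b.flip :=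
    bijective_weilCupProduct_infinitePlace W n e hμ hadd₁ hadd₂ w hgal halt hnondeg (inv (Sum.inl w)) hι b
      (fun x y ↦ X11b.Relaxation.invWeilPairing_apply W n e hμ hadd₁ hadd₂ hgal inv (Sum.inl w) x y)
  have hNL : Nat.card (annRight b L) * Nat.card L =
      Nat.card (galoisCohomology ((W.torsionGaloisModule n).toLocal (Sum.inl w)) 1) :=
    natCard_annRight_mul hA b hp.2 L
  rw [annRight_invWeilPairing_kummerSelmerStructure_inl_of_injective W n e hμ hadd₁ hadd₂ hgal halt hnondeg inv w hι] at hNL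
  exact hNL.symm

/-- **THE ARCHIMEDEAN KUMMER COUNT** (the companion, at an INFINITE place, of X5's `relIndex_kummer_update_bot_update_top_eq`): for
`n = p^k`, any number field `K`, any `E/K`, any infinite place `w`, a family `inv` with the four Poitou–Tate properties AND injective at
the real places (`hreal`), and Tate's local Euler characteristic at the finite places (`hEP`, for the self-duality of the Kummer structure
there): `[Sel^{(n)} relaxed at w : Sel^{(n)} strict at w] = #𝓛_w`, where `𝓛_w = kummerSelmerStructure n (Sum.inl w)` is the image of
`E(K_w)/nE(K_w)` (order `[E(K_w) : nE(K_w)]`, `natCard_kummerLocalConditionAt_eq_index`). At a complex place `#𝓛_w = 1`; at a real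
place and `n = 2` it is `#E(K_w)/2E(K_w)` = `2` or `1` according as `Δ_w > 0` or `< 0` (Kramer 1981 Prop. 6). This is the «Howard
count at ∞» that Mazur–Rubin's Prop. 3.3 with an archimedean `T`-place (the cell's T-A / T-V / T-C) consumes.
[cite: MilneADT2006, Ch. I, Ex. 1.6 (c), Thm. 2.13, Thm. 4.10 and Lemma 6.15] [cite: Howard2004HeegnerKolyvagin, Thm. 2.1.11 (arXiv:1202.6340 p. 6)]
[cite: Kramer1981, Prop. 6] -/
theorem relIndex_kummer_update_bot_update_top_inl_eq (hn : IsPrimePow n)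
    (hperf : inv.IsPerfect) (hvan : inv.SumLocalTermEqZero) (hcomp : inv.SelmerComplement)
    (hEP : ∀ v : HeightOneSpectrum (𝓞 K), localEulerPoincareCharacteristic (v.adicCompletion K))
    (hreal : ∀ w : InfinitePlace K, w.IsReal → Injective (inv (Sum.inl w)))
    (w : InfinitePlace K) :
    (SelmerStructure.selmerGroup (Function.update (W.kummerSelmerStructure (n : ℤ))
          (Sum.inl w) ⊥ : SelmerStructure (W.torsionGaloisModule (n : ℤ)))).relIndex
        (SelmerStructure.selmerGroup (Function.update (W.kummerSelmerStructure (n : ℤ))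
          (Sum.inl w) ⊤ : SelmerStructure (W.torsionGaloisModule (n : ℤ)))) =
      Nat.card (W.kummerSelmerStructure (n : ℤ) (Sum.inl w)) := by
  -- complex places: `H¹(K_w, E[n]) = 0`, so both modifications ARE the Kummer structure and `#𝓛_w = 1`
  rcases w.isReal_or_isComplex with hw | hw
  swap
  · have htop : ∀ L : AddSubgroup (galoisCohomology ((W.torsionGaloisModule (n : ℤ)).toLocal (Sum.inl w)) 1), L = ⊤ :=
      fun L ↦ eq_top_of_isComplex (W.torsionGaloisModule (n : ℤ)) hw L
    have h1 : Function.update (W.kummerSelmerStructure (n : ℤ)) (Sum.inl w) ⊥ = W.kummerSelmerStructure (n : ℤ) := by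
      funext v
      by_cases hv : v = Sum.inl w
      · subst hv; rw [Function.update_self, htop ⊥, htop (W.kummerSelmerStructure (n : ℤ) (Sum.inl w))]
      · rw [Function.update_of_ne hv]
    have h2 : Function.update (W.kummerSelmerStructure (n : ℤ)) (Sum.inl w) ⊤ = W.kummerSelmerStructure (n : ℤ) := by
      funext v
      by_cases hv : v = Sum.inl w
      · subst hv; rw [Function.update_self, htop (W.kummerSelmerStructure (n : ℤ) (Sum.inl w))]
      · rw [Function.update_of_ne hv]
    rw [h1, h2, AddSubgroup.relIndex_self, htop (W.kummerSelmerStructure (n : ℤ) (Sum.inl w)), AddSubgroup.card_top]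
    haveI : Subsingleton (galoisCohomology ((W.torsionGaloisModule (n : ℤ)).toLocal (Sum.inl w)) 1) := by
      refine ⟨fun x y ↦ ?_⟩
      have hx : x ∈ (⊥ : AddSubgroup _) := by rw [htop ⊥]; exact AddSubgroup.mem_top x
      have hy : y ∈ (⊥ : AddSubgroup _) := by rw [htop ⊥]; exact AddSubgroup.mem_top y
      rw [AddSubgroup.mem_bot] at hx hy
      rw [hx, hy]
    exact (Nat.card_of_subsingleton (0 : galoisCohomology ((W.torsionGaloisModule (n : ℤ)).toLocal (Sum.inl w)) 1)).symm
  -- real places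
  -- `n = p^k`, `p` prime, `k ≥ 1`
  obtain ⟨p, k, hp, hk, rfl⟩ := (isPrimePow_nat_iff n).mp hn
  haveI : Fact p.Prime := ⟨hp⟩
  -- a Weil pairing on `E[p^k]` (PROVED in the tree: `exists_weilPairing_holds`, Silverman III.8.1)
  obtain ⟨e, hμ, hadd₁, hadd₂, halt, hnondeg, hgal⟩ := exists_weilPairing_holds W (p ^ k)
    (hp.two_le.trans (Nat.le_self_pow hk.ne' p)) (Nat.cast_ne_zero.mpr (NeZero.ne (p ^ k)))
  -- a finite exceptional set `S ⊇ {w} ∪ ∞ ∪ {v ∣ p} ∪ {bad}` (every infinite place is in `S`)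
  obtain ⟨S, -, hinf, hpS, hbad⟩ := X11b.KummerPT.exists_exceptional_finset W p (∅ : Finset (Place K))
  have hwS : (Sum.inl w : Place K) ∈ S := hinf w
  have hS : ∀ v : HeightOneSpectrum (𝓞 K), (Sum.inr v : Place K) ∉ S →
      (((p ^ k : ℕ) : ℕ) : 𝓞 K) ∉ v.asIdeal ∧
        GaloisRep.IsUnramifiedAt v (W.torsionGaloisModule ((p ^ k : ℕ) : ℤ)) := fun v hv => by
    have hpv : ((p : ℕ) : 𝓞 K) ∉ v.asIdeal := fun h => hv (hpS v h)
    have hgood : W.HasGoodReductionAt v := by_contra fun h => hv (hbad v h)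
    have hpkv : ((p ^ k : ℕ) : 𝓞 K) ∉ v.asIdeal := by
      rw [Nat.cast_pow]
      exact fun h => hpv (v.isPrime.mem_of_pow_mem k h)
    exact ⟨hpkv, X11b.AcSelmer.isUnramifiedAt_torsionGaloisModule W hgood
      (by rw [Int.cast_natCast]; exact hpkv)⟩
  have h𝓚 : SelmerStructure.IsUnramifiedOutside (W.kummerSelmerStructure ((p ^ k : ℕ) : ℤ)) S :=
    X11b.KummerDuality.kummerSelmerStructure_isUnramifiedOutside W p k S hinf hpS hbad
  have hι : Injective (inv (Sum.inl w)) := hreal w hw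
  have hsq := relIndex_update_bot_update_top_sq_eq_natCard_inl W (p ^ k) e hμ hadd₁ hadd₂ hgal halt hnondeg inv hvan hcomp hS h𝓚
    hwS hι (fun v _ => dualTransported_kummerSelmerStructure_eq W (p ^ k) e hμ hadd₁ hadd₂ hgal halt hnondeg inv hn hperf hEP
      hreal v)
  rw [natCard_galoisCohomology_one_torsion_inl_eq_sq W (p ^ k) e hμ hadd₁ hadd₂ hgal halt hnondeg inv w hι, ← sq] at hsq
  exact (Nat.pow_left_injective two_ne_zero) hsq

/-- **The archimedean Kummer count in the `kummerStrict` / `kummerRelaxed` spelling of X11b** (`KummerPT`):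
`[H¹_{kummerRelaxed {w}} : H¹_{kummerStrict {w}}] = #𝓛_w` at an infinite place `w` (hypotheses as in
`relIndex_kummer_update_bot_update_top_inl_eq`). [cite: MilneADT2006, Ch. I, Thm. 2.13, Thm. 4.10 and Lemma 6.15]
[cite: Howard2004HeegnerKolyvagin, Thm. 2.1.11 (arXiv:1202.6340 p. 6)] -/
theorem relIndex_kummerStrict_kummerRelaxed_singleton_inl_eq (hn : IsPrimePow n)
    (hperf : inv.IsPerfect) (hvan : inv.SumLocalTermEqZero) (hcomp : inv.SelmerComplement)
    (hEP : ∀ v : HeightOneSpectrum (𝓞 K), localEulerPoincareCharacteristic (v.adicCompletion K))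
    (hreal : ∀ w : InfinitePlace K, w.IsReal → Injective (inv (Sum.inl w)))
    (w : InfinitePlace K) :
    (X11b.KummerPT.kummerStrict W n {(Sum.inl w : Place K)}).selmerGroup.relIndex
        (X11b.KummerPT.kummerRelaxed W n {(Sum.inl w : Place K)}).selmerGroup =
      Nat.card (W.kummerSelmerStructure (n : ℤ) (Sum.inl w)) := by
  rw [kummerStrict_singleton_eq_update, kummerRelaxed_singleton_eq_update]
  exact relIndex_kummer_update_bot_update_top_inl_eq W n inv hn hperf hvan hcomp hEP hreal w

/-- **The archimedean Kummer count, `inv`-free, CONDITIONAL on the two named facts** `poitouTate_selmerStructure_duality_real K`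
(Milne I Thm. 4.10 + Ex. 1.6 (c): the family, injective at the real places) and `localEulerPoincareCharacteristic` (Tate, Milne I Thm. 2.8):
for `n = p^k` and any infinite place `w` of `K`, `[Sel^{(n)} relaxed at w : Sel^{(n)} strict at w] = #𝓛_w` (= `[E(K_w) : nE(K_w)]`).
The real-place companion of X11b's `relIndex_kummerStrict_kummerRelaxed_singleton_eq_of_facts` used by every transfer theorem of the
cell at a finite twisting prime; with it, Mazur–Rubin's Prop. 3.3 / Cor. 3.4 (i) at `T = {∞}` needs only the transversality of the two
Kummer lines at `∞` (Kramer Prop. 6). [cite: MilneADT2006, Ch. I, Ex. 1.6 (c), Thm. 2.13 and Thm. 4.10] [cite: MazurRubin2010, Prop. 3.3]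
[cite: Kramer1981, Prop. 6] -/
theorem relIndex_kummerStrict_kummerRelaxed_singleton_inl_eq_of_facts (hn : IsPrimePow n)
    (hPT : poitouTate_selmerStructure_duality_real K)
    (hEP : ∀ v : HeightOneSpectrum (𝓞 K), localEulerPoincareCharacteristic (v.adicCompletion K))
    (w : InfinitePlace K) :
    (X11b.KummerPT.kummerStrict W n {(Sum.inl w : Place K)}).selmerGroup.relIndex
        (X11b.KummerPT.kummerRelaxed W n {(Sum.inl w : Place K)}).selmerGroup =
      Nat.card (W.kummerSelmerStructure (n : ℤ) (Sum.inl w)) := by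
  obtain ⟨inv, hperf, hvan, -, hcomp, hreal⟩ := hPT n
  exact relIndex_kummerStrict_kummerRelaxed_singleton_inl_eq W n inv hn hperf hvan hcomp hEP hreal w

end RealPlace

end Summit.BirchSwinnertonDyer.BirchSwinnertonDyer.Theorems.GenusKolyArch

end
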